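import Literature.NumberTheory.LFunctions.InghamSmoothing
import HarnessLib

/-!
# Ingham's smoothing method, the Anderson–Stark refinement (abstract form): oscillation about the mean of `Q · Re S` for a non-negative weight `Q` of mean one

Topic `Literature/NumberTheory/LFunctions`; namespace `Literature.NumberTheory.LFunctions.InghamSmoothing`, continuing
`InghamSmoothing.lean`. That file proves Ingham's oscillation theorem in the abstract form of
Bateman–Diamond, Thm. 11.12 / Odlyzko–te Riele 1985, §2: if every one-sided bound on `f` yields
the Laplace representation `Σ aᵢ/(s − iγᵢ) + R(s)`, then `f(y) > Re S(y₀) − ε` and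
`f(y) < Re S(y₀) + ε` for arbitrarily large `y`, `S(y) = Σ aᵢ k(γᵢ) e^{iγᵢy}`. Here we prove the
one further step behind the theorem of Anderson–Stark used by Grosswald and Best–Trudgian
(Best–Trudgian 2015, Theorem 2; R. J. Anderson, H. M. Stark, *Oscillation theorems*, LNM 899
(1981)): the point value `Re S(y₀)` may be replaced by the **mean value of `Q · Re S`** for any
continuous weight `Q ≥ 0` of mean value `1`,

> `liminf f ≤ M[Q · Re S] ≤ limsup f`, `M[g] = lim_{U→∞} U⁻¹ ∫_Y^{Y+U} g`,

(`frequently_gt_of_laplace_of_mean`, `frequently_lt_of_laplace_of_mean`,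
`frequently_gt_and_lt_of_laplace_of_mean`). The weight of Anderson–Stark is a product of Fejér
kernels `Π_γ F_{N_γ}(γy + θ_γ)` in the frequencies of a `{N_γ}`-independent set, whose means
against `1` and against `Re S` are computed from the independence hypothesis elsewhere
(`FejerProductMeans.lean`); the present file is independent of that choice and of `ζ`.

## The argument (as in the proof of Best–Trudgian's Theorem 2 / Anderson–Stark)

Suppose `f(y) ≤ V − ε` for `y ≥ y₁`, where `V = M[Q · Re S]`. This one-sided bound feeds
`SmoothingData`, so the smoothed explicit formula (`SmoothingData.smoothed_explicit_formula`,
Bateman–Diamond (11.7)) gives `∫ K(y−u)f(u)du = Re S(y) + o(1)`, while averaging the bound against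
the mass-one kernel (`eventually_average_le`) gives `∫ K(y−u)f(u)du ≤ V − ε + ε/4` for large `y`;
hence `Re S(y) ≤ V − ε/2` for `y ≥ Y`. Multiplying by `Q(y) ≥ 0` and averaging over `[Y, Y+U]`,
`U⁻¹∫ Q·Re S ≤ (V − ε/2)·U⁻¹∫ Q`; letting `U → ∞`, `V ≤ V − ε/2`, a contradiction. The lower half
is the upper half for `−f` (coefficients `−aᵢ`, regular part `−R`).

## References

* [BestTrudgian2015] D. G. Best, T. S. Trudgian, *Linear relations of zeroes of the
  zeta-function*, Math. Comp. 84 (2015), §2, Theorem 2 and (2.3) (Ingham's theorem), read from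
  arXiv:1209.3843; R. J. Anderson, H. M. Stark, *Oscillation theorems*, LNM 899 (1981) 79–106
  (cited through it).
* [BatemanDiamond2004] P. T. Bateman, H. G. Diamond, *Analytic Number Theory*, World Scientific
  2004, Thm. 11.12 and Remarks 11.13 (the framework of `InghamSmoothing.lean`).
* [Ingham1942] A. E. Ingham, *On two conjectures in the theory of numbers*, Amer. J. Math. 64
  (1942) 313–319.
-/

noncomputable section

open Complex Filter MeasureTheory Set Topology

namespace Literature.NumberTheory.LFunctions
namespace InghamSmoothing

/-- The oscillating sum `S(y) = Σ aᵢ k(γᵢ) e^{iγᵢ y}` has continuous real part. [folklore] -/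
theorem continuous_re_trigSum {ι : Type*} (P : Finset ι) (γ : ι → ℝ) (b : ι → ℂ) :
    Continuous fun y : ℝ ↦ (∑ i ∈ P, b i * cexp (((γ i * y : ℝ) : ℂ) * I)).re := by
  refine Complex.continuous_re.comp (continuous_finsetSum _ fun i _ ↦ ?_)
  fun_prop

/-- **Anderson–Stark averaging, abstract form, upper half.** In the setting of
`frequently_gt_of_laplace` (every *upper* bound on `f` yields the Laplace representation), let
`Q ≥ 0` be continuous with mean value `1` (`U⁻¹∫_Y^{Y+U} Q → 1`) and let
`U⁻¹∫_Y^{Y+U} Q · Re S → V` (for every `Y`), `S(y) = Σ aᵢ k(γᵢ) e^{iγᵢ y}`. Then for every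
`ε > 0`, `f(y) > V − ε` for arbitrarily large `y`: "`limsup f ≥ M[Q · Re S]`".
[cite: BestTrudgian2015, Theorem 2 (proof)] -/
theorem frequently_gt_of_laplace_of_mean {ι : Type*} (P : Finset ι) (γ : ι → ℝ) (a : ι → ℂ)
    {f K : ℝ → ℝ} {k : ℝ → ℂ} {σ₀ T' : ℝ}
    (hfm : Measurable f) (hf0 : ∀ u, u < 0 → f u = 0) (hfloc : ∀ b, ∃ B, ∀ u, u ≤ b → |f u| ≤ B)
    (hKc : Continuous K) (hKnn : ∀ v, 0 ≤ K v) (hKi : Integrable K) (hK1 : ∫ v, K v = 1)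
    (hk : ∀ t, k t = ∫ y, (K y : ℂ) * cexp (-((t * y : ℝ) : ℂ) * I))
    (hks : ∀ t, T' ≤ |t| → k t = 0) (hσ₀ : 0 < σ₀)
    (hL : ∀ A : ℝ, (∀ u, f u ≤ A) →
      (∀ σ, 0 < σ → Integrable (fun u ↦ f u * Real.exp (-(σ * u)))) ∧
      ∃ R : ℂ → ℂ, ContinuousOn R (Set.Icc 0 σ₀ ×ℂ Set.Icc (-T') T') ∧
        ∀ σ t : ℝ, 0 < σ → σ ≤ σ₀ → |t| ≤ T' →
          ∫ u, (f u : ℂ) * cexp (-(((σ : ℂ) + t * I) * u)) =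
            ∑ i ∈ P, a i / ((σ : ℂ) + t * I - γ i * I) + R (σ + t * I))
    {Q : ℝ → ℝ} (hQc : Continuous Q) (hQnn : ∀ y, 0 ≤ Q y) {V : ℝ}
    (hQ1 : ∀ Y : ℝ, Tendsto (fun U : ℝ ↦ U⁻¹ * ∫ y in Y..Y + U, Q y) atTop (𝓝 1))
    (hQS : ∀ Y : ℝ, Tendsto (fun U : ℝ ↦ U⁻¹ * ∫ y in Y..Y + U,
      Q y * (∑ i ∈ P, a i * k (γ i) * cexp (((γ i * y : ℝ) : ℂ) * I)).re) atTop (𝓝 V))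
    {ε : ℝ} (hε : 0 < ε) :
    ∃ᶠ y in atTop, V - ε < f y := by
  set S : ℝ → ℂ := fun y ↦ ∑ i ∈ P, a i * k (γ i) * cexp (((γ i * y : ℝ) : ℂ) * I) with hS
  by_contra hcon
  rw [not_frequently] at hcon
  obtain ⟨y₁, hy₁⟩ := eventually_atTop.1 hcon
  -- a global upper bound
  obtain ⟨B, hB⟩ := hfloc y₁
  set A : ℝ := max (V - ε) B with hA
  have hfa : ∀ u, y₁ ≤ u → f u ≤ V - ε := fun u hu ↦ not_lt.1 (hy₁ u hu)
  have hfA : ∀ u, f u ≤ A := by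
    intro u
    rcases le_or_gt y₁ u with hu | hu
    · exact (hfa u hu).trans (le_max_left _ _)
    · exact ((le_abs_self _).trans (hB u hu.le)).trans (le_max_right _ _)
  obtain ⟨hint, R, hRc, hRe⟩ := hL A hfA
  have hD : SmoothingData P γ a f K k R A σ₀ T' :=
    ⟨hfm, hf0, hfA, hint, hKc, hKnn, hKi, hk, hks, hσ₀, hRc, hRe⟩
  obtain ⟨hIf, hT⟩ := hD.smoothed_explicit_formula
  -- averaging: eventually `∫ K(y-u) f(u) du ≤ V - ε + ε/4`, hence `Re S(y) ≤ V - ε/2`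
  have hε4 : 0 < ε / 4 := by positivity
  have hav := eventually_average_le hKnn hKi hK1 hfa (fun u hu ↦ hB u hu.le) hIf hε4
  have hev : ∀ᶠ y in atTop, (S y).re ≤ V - ε / 2 := by
    have h2 := (Metric.tendsto_nhds.1 hT) (ε / 4) hε4
    filter_upwards [hav, h2] with y h1 h3
    rw [Real.dist_eq, sub_zero] at h3
    have := (abs_lt.1 h3).1
    linarith
  obtain ⟨Y, hY⟩ := eventually_atTop.1 hev
  -- multiply by `Q ≥ 0` and average over `[Y, Y + U]`
  have hSc : Continuous fun y ↦ (S y).re := continuous_re_trigSum P γ fun i ↦ a i * k (γ i)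
  have hle : ∀ U : ℝ, 0 < U →
      U⁻¹ * ∫ y in Y..Y + U, Q y * (S y).re ≤ (V - ε / 2) * (U⁻¹ * ∫ y in Y..Y + U, Q y) := by
    intro U hU
    have hrw : (V - ε / 2) * (U⁻¹ * ∫ y in Y..Y + U, Q y) =
        U⁻¹ * ∫ y in Y..Y + U, (V - ε / 2) * Q y := by
      rw [intervalIntegral.integral_const_mul]; ring
    rw [hrw]
    refine mul_le_mul_of_nonneg_left ?_ (inv_nonneg.2 hU.le)
    refine intervalIntegral.integral_mono_on (by linarith) ?_ ?_ fun y hy ↦ ?_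
    · exact (hQc.mul hSc).intervalIntegrable _ _
    · exact (continuous_const.mul hQc).intervalIntegrable _ _
    · have h1 := hY y hy.1
      have h2 := hQnn y
      nlinarith
  -- `U → ∞`: `V ≤ (V - ε/2) · 1`
  have hlim : V ≤ (V - ε / 2) * 1 :=
    le_of_tendsto_of_tendsto (hQS Y) ((hQ1 Y).const_mul (V - ε / 2))
      (by filter_upwards [eventually_gt_atTop 0] with U hU using hle U hU)
  linarith

/-- **Anderson–Stark averaging, abstract form, lower half:** if every *lower* bound on `f` yields
the Laplace representation, then with `Q`, `V` as above, `f(y) < V + ε` for arbitrarily large `y`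
("`liminf f ≤ M[Q · Re S]`"). Proof: the upper half for `−f`, `−aᵢ`, `−R`.
[cite: BestTrudgian2015, Theorem 2 (proof)] -/
theorem frequently_lt_of_laplace_of_mean {ι : Type*} (P : Finset ι) (γ : ι → ℝ) (a : ι → ℂ)
    {f K : ℝ → ℝ} {k : ℝ → ℂ} {σ₀ T' : ℝ}
    (hfm : Measurable f) (hf0 : ∀ u, u < 0 → f u = 0) (hfloc : ∀ b, ∃ B, ∀ u, u ≤ b → |f u| ≤ B)
    (hKc : Continuous K) (hKnn : ∀ v, 0 ≤ K v) (hKi : Integrable K) (hK1 : ∫ v, K v = 1)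
    (hk : ∀ t, k t = ∫ y, (K y : ℂ) * cexp (-((t * y : ℝ) : ℂ) * I))
    (hks : ∀ t, T' ≤ |t| → k t = 0) (hσ₀ : 0 < σ₀)
    (hL : ∀ A : ℝ, (∀ u, -A ≤ f u) →
      (∀ σ, 0 < σ → Integrable (fun u ↦ f u * Real.exp (-(σ * u)))) ∧
      ∃ R : ℂ → ℂ, ContinuousOn R (Set.Icc 0 σ₀ ×ℂ Set.Icc (-T') T') ∧
        ∀ σ t : ℝ, 0 < σ → σ ≤ σ₀ → |t| ≤ T' →
          ∫ u, (f u : ℂ) * cexp (-(((σ : ℂ) + t * I) * u)) =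
            ∑ i ∈ P, a i / ((σ : ℂ) + t * I - γ i * I) + R (σ + t * I))
    {Q : ℝ → ℝ} (hQc : Continuous Q) (hQnn : ∀ y, 0 ≤ Q y) {V : ℝ}
    (hQ1 : ∀ Y : ℝ, Tendsto (fun U : ℝ ↦ U⁻¹ * ∫ y in Y..Y + U, Q y) atTop (𝓝 1))
    (hQS : ∀ Y : ℝ, Tendsto (fun U : ℝ ↦ U⁻¹ * ∫ y in Y..Y + U,
      Q y * (∑ i ∈ P, a i * k (γ i) * cexp (((γ i * y : ℝ) : ℂ) * I)).re) atTop (𝓝 V))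
    {ε : ℝ} (hε : 0 < ε) :
    ∃ᶠ y in atTop, f y < V + ε := by
  -- data for `-f`
  have hL' : ∀ A : ℝ, (∀ u, -f u ≤ A) →
      (∀ σ, 0 < σ → Integrable (fun u ↦ -f u * Real.exp (-(σ * u)))) ∧
      ∃ R : ℂ → ℂ, ContinuousOn R (Set.Icc 0 σ₀ ×ℂ Set.Icc (-T') T') ∧
        ∀ σ t : ℝ, 0 < σ → σ ≤ σ₀ → |t| ≤ T' →
          ∫ u, ((-f u : ℝ) : ℂ) * cexp (-(((σ : ℂ) + t * I) * u)) =
            ∑ i ∈ P, (-a i) / ((σ : ℂ) + t * I - γ i * I) + R (σ + t * I) := by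
    intro A hA
    obtain ⟨hint, R, hRc, hRe⟩ := hL A (fun u ↦ by linarith [hA u])
    refine ⟨fun σ hσ ↦ ?_, fun s ↦ -R s, hRc.neg, fun σ t hσ hσ' ht ↦ ?_⟩
    · exact ((hint σ hσ).neg).congr (ae_of_all _ fun u ↦ by simp only [Pi.neg_apply, neg_mul])
    · have h1 : ∫ u, ((-f u : ℝ) : ℂ) * cexp (-(((σ : ℂ) + t * I) * u)) =
          -∫ u, (f u : ℂ) * cexp (-(((σ : ℂ) + t * I) * u)) := by
        rw [← integral_neg]
        refine integral_congr_ae (ae_of_all _ fun u ↦ ?_)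
        push_cast; ring
      rw [h1, hRe σ t hσ hσ' ht, neg_add, ← Finset.sum_neg_distrib]
      congr 1
      exact Finset.sum_congr rfl fun i _ ↦ by rw [neg_div]
  -- the sum for `-a` is `-S`, so its `Q`-mean is `-V`
  have hneg : ∀ y : ℝ, (∑ i ∈ P, -a i * k (γ i) * cexp (((γ i * y : ℝ) : ℂ) * I)).re =
      -(∑ i ∈ P, a i * k (γ i) * cexp (((γ i * y : ℝ) : ℂ) * I)).re := by
    intro y
    rw [← Complex.neg_re, ← Finset.sum_neg_distrib]
    congr 1
    exact Finset.sum_congr rfl fun i _ ↦ by ring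
  have hQS' : ∀ Y : ℝ, Tendsto (fun U : ℝ ↦ U⁻¹ * ∫ y in Y..Y + U,
      Q y * (∑ i ∈ P, -a i * k (γ i) * cexp (((γ i * y : ℝ) : ℂ) * I)).re) atTop (𝓝 (-V)) := by
    intro Y
    have h := (hQS Y).neg
    refine h.congr fun U ↦ ?_
    rw [← mul_neg, ← intervalIntegral.integral_neg]
    congr 1
    refine intervalIntegral.integral_congr fun y _ ↦ ?_
    simp only [hneg, mul_neg]
  have h := frequently_gt_of_laplace_of_mean P γ (fun i ↦ -a i) (f := fun u ↦ -f u) hfm.neg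
    (fun u hu ↦ by simp [hf0 u hu]) (fun b ↦ ?_) hKc hKnn hKi hK1 hk hks hσ₀ hL' hQc hQnn hQ1
    hQS' hε
  · exact h.mono fun y hy ↦ by linarith
  · obtain ⟨B, hB⟩ := hfloc b
    exact ⟨B, fun u hu ↦ by rw [abs_neg]; exact hB u hu⟩

/-- **Anderson–Stark averaging, abstract form** ("`liminf f ≤ M[Q · Re S] ≤ limsup f`"): if
*each* one-sided bound on `f` yields the Laplace representation (as in
`frequently_gt_and_lt_of_laplace`), then for every continuous `Q ≥ 0` of mean one with
`U⁻¹∫_Y^{Y+U} Q · Re S → V` and every `ε > 0`: `f(y) > V − ε` and `f(y) < V + ε` for arbitrarily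
large `y`. With `Q = 1` and `V = Re S(y₀)` recovered through almost periodicity this is Ingham's
theorem; Anderson–Stark take `Q` a product of Fejér kernels in `{N_γ}`-independent frequencies.
[cite: BestTrudgian2015, Theorem 2 (proof)] -/
theorem frequently_gt_and_lt_of_laplace_of_mean {ι : Type*} (P : Finset ι) (γ : ι → ℝ)
    (a : ι → ℂ) {f K : ℝ → ℝ} {k : ℝ → ℂ} {σ₀ T' : ℝ}
    (hfm : Measurable f) (hf0 : ∀ u, u < 0 → f u = 0) (hfloc : ∀ b, ∃ B, ∀ u, u ≤ b → |f u| ≤ B)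
    (hKc : Continuous K) (hKnn : ∀ v, 0 ≤ K v) (hKi : Integrable K) (hK1 : ∫ v, K v = 1)
    (hk : ∀ t, k t = ∫ y, (K y : ℂ) * cexp (-((t * y : ℝ) : ℂ) * I))
    (hks : ∀ t, T' ≤ |t| → k t = 0) (hσ₀ : 0 < σ₀)
    (hL : ∀ A : ℝ, ((∀ u, f u ≤ A) ∨ (∀ u, -A ≤ f u)) →
      (∀ σ, 0 < σ → Integrable (fun u ↦ f u * Real.exp (-(σ * u)))) ∧
      ∃ R : ℂ → ℂ, ContinuousOn R (Set.Icc 0 σ₀ ×ℂ Set.Icc (-T') T') ∧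
        ∀ σ t : ℝ, 0 < σ → σ ≤ σ₀ → |t| ≤ T' →
          ∫ u, (f u : ℂ) * cexp (-(((σ : ℂ) + t * I) * u)) =
            ∑ i ∈ P, a i / ((σ : ℂ) + t * I - γ i * I) + R (σ + t * I))
    {Q : ℝ → ℝ} (hQc : Continuous Q) (hQnn : ∀ y, 0 ≤ Q y) {V : ℝ}
    (hQ1 : ∀ Y : ℝ, Tendsto (fun U : ℝ ↦ U⁻¹ * ∫ y in Y..Y + U, Q y) atTop (𝓝 1))
    (hQS : ∀ Y : ℝ, Tendsto (fun U : ℝ ↦ U⁻¹ * ∫ y in Y..Y + U,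
      Q y * (∑ i ∈ P, a i * k (γ i) * cexp (((γ i * y : ℝ) : ℂ) * I)).re) atTop (𝓝 V))
    {ε : ℝ} (hε : 0 < ε) :
    (∃ᶠ y in atTop, V - ε < f y) ∧ (∃ᶠ y in atTop, f y < V + ε) :=
  ⟨frequently_gt_of_laplace_of_mean P γ a hfm hf0 hfloc hKc hKnn hKi hK1 hk hks hσ₀
      (fun A hA ↦ hL A (Or.inl hA)) hQc hQnn hQ1 hQS hε,
    frequently_lt_of_laplace_of_mean P γ a hfm hf0 hfloc hKc hKnn hKi hK1 hk hks hσ₀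
      (fun A hA ↦ hL A (Or.inr hA)) hQc hQnn hQ1 hQS hε⟩

end InghamSmoothing
end Literature.NumberTheory.LFunctions

end
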